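import Summits.CriticalPhenomena.SAWScalingLimit.Theses.SAWRestrictionRigidity
import Summits.CriticalPhenomena.SAWScalingLimit.Theorems.SAWRestrictionRigidityLimitExistsStubPortmanteau
import Summits.CriticalPhenomena.SAWScalingLimit.Theorems.SubseqIdentification.Negative.Necessity
import Literature.Probability.RandomPlanarGeometry.ConformalRestrictionProofs
import HarnessLib

/-!
# Crux `LimitExists` (stmt-CriticalPhenomena-1371), line `registered` — what the avoidance stub (C) adds

Loss analysis of the registered stub (C) = `AvoidanceCocycleLimit` (stmt-CriticalPhenomena-1369) of the
line `registered` (`Cruxes/LimitExists/Lines/birth.lean`; items form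
`LimitExists_of_items : EventualTight → SimpleSubseqLimits → AvoidanceCocycleLimit → LimitExists`,
`Theorems/SAWRestrictionRigidityLimitExists.lean`).  Modulo the crux itself, (C) is EXACTLY a regularity
property of the full limit `P`: if `P D` gives no mass to the chords that stay in `cl D'` but TOUCH the
closure of the carved region `cl D ∖ cl D'` ("touching `∂D'` from inside without entering"), then the
hull-avoidance probabilities converge along the full filter `δ → 0⁺` — to `P D (range ⊆ cl D')`.

* `avoidanceCocycleLimit_of_limit_nullTouching` — `(∃ P, P.IsChordal ∧ (lim) ∧ NullTouching P) →
  AvoidanceCocycleLimit`.  Proof: along every mesh sequence `sₙ → 0⁺` (the filter `𝓝[>] 0` is countably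
  generated) the portmanteau inequalities of `stub_portmanteau` give `limsup Pₙ(A) ≤ P D (A)` for the
  CLOSED event `A = rangeSubset (cl D')` and `P D (O) ≤ liminf Pₙ(O)` for the OPEN event
  `O = rangeSubset (closure (cl D ∖ cl D'))ᶜ` (`CurveClass.isOpen_rangeSubset`); lattice curves live in
  `cl D` (`range_curve_subset_closure`), so `Pₙ(O) ≤ Pₙ(A)` eventually, and `A ⊆ O ∪ T` with `T` the
  null touching event, so `P D (A) ≤ P D (O)`; squeeze.

For the chordal SLE_{8/3} law the touching event is null (conformal restriction, LSW03 Thm. 6.1 and the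
tree's `HullRestrictionNull`), so this is the precise sense in which (C) is implied by the summit
conjunct; here only the abstract statement is recorded.  Everything proved, standard axioms.
[cite: BillingsleyCPM1999, Thm. 2.1]
-/

noncomputable section

open Literature.Probability.RandomPlanarGeometry Literature.Probability.RandomPlanarGeometry.SAW
  Literature.Probability.LatticeModels Literature.Probability MeasureTheory Filter Topology Set
open scoped NNReal ENNReal BoundedContinuousFunction

namespace Summit.CriticalPhenomena.SAWScalingLimit.Theorems.SAWRestrictionRigidityLimitExists

open Summit.CriticalPhenomena.SAWScalingLimit.Theorems.SubseqIdentification.Negative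
  (range_curve_subset_closure eventually_ne_of_hyps)
open Summit.CriticalPhenomena.SAWScalingLimit.Theses.SAWRestrictionRigidity (LimitExists AvoidanceCocycleLimit)

/-- **Avoidance probabilities converge when the limit does not charge the touching event.**  For one
Dobrushin domain `D`, an endpoint approximation `(a_δ, b_δ)`, a probability measure `P` on `CurveClass ℂ`
that is the weak limit of the pushed critical SAW laws along `δ → 0⁺`, and a closed set `S ⊆ ℂ`
(intended: `S = cl D'` for a hull subdomain `D'`): if `P {γ | range γ ⊆ S ∧ range γ ∩ cl (cl D ∖ S) ≠ ∅} = 0`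
then `P_δ(range ⊆ S) → P (range ⊆ S)` along `𝓝[>] 0`.  Portmanteau squeeze between the closed event
`rangeSubset S` and the open event `rangeSubset (cl (cl D ∖ S))ᶜ`, which agree on lattice curves (they
live in `cl D`) and `P`-a.e. [cite: BillingsleyCPM1999, Thm. 2.1] -/
theorem tendsto_measure_rangeSubset_of_nullTouching {D : DobrushinDomain} {a b : ℝ → Site 2}
    (hab : IsEndpointApprox D a b) {P : Measure (CurveClass ℂ)} [hP : IsProbabilityMeasure P]
    (hlim : ∀ f : CurveClass ℂ →ᵇ ℝ, Tendsto
      (fun δ => ∫ γ, f γ.curve ∂law D.carrier δ (a δ) (b δ)) (𝓝[>] (0 : ℝ)) (𝓝 (∫ x, f x ∂P)))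
    {S : Set ℂ} (hS : IsClosed S)
    (hnull : P {γ | γ.range ⊆ S ∧ (γ.range ∩ closure (closure D.carrier \ S)).Nonempty} = 0) :
    Tendsto (fun δ => ((law D.carrier δ (a δ) (b δ)).map (fun γ => γ.curve))
      (CurveClass.rangeSubset S)) (𝓝[>] (0 : ℝ)) (𝓝 (P (CurveClass.rangeSubset S))) := by
  classical
  -- the two events
  set A : Set (CurveClass ℂ) := CurveClass.rangeSubset S with hA
  set W : Set ℂ := (closure (closure D.carrier \ S))ᶜ with hW
  set O : Set (CurveClass ℂ) := CurveClass.rangeSubset W with hO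
  have hAclosed : IsClosed A := CurveClass.isClosed_rangeSubset hS
  have hOopen : IsOpen O := CurveClass.isOpen_rangeSubset isClosed_closure.isOpen_compl
  -- `A ⊆ O ∪ T`, `T` null, so `P A ≤ P O`
  have hPAO : P A ≤ P O := by
    have hsub : A ⊆ O ∪ {γ | γ.range ⊆ S ∧ (γ.range ∩ closure (closure D.carrier \ S)).Nonempty} := by
      intro γ hγ
      by_cases hγO : γ ∈ O
      · exact Or.inl hγO
      · refine Or.inr ⟨hγ, ?_⟩
        by_contra hne
        apply hγO
        intro x hx
        show x ∈ (closure (closure D.carrier \ S))ᶜ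
        intro hx'
        exact hne ⟨x, hx, hx'⟩
    calc P A ≤ P (O ∪ {γ | γ.range ⊆ S ∧ (γ.range ∩ closure (closure D.carrier \ S)).Nonempty}) :=
          measure_mono hsub
      _ ≤ P O + P {γ | γ.range ⊆ S ∧ (γ.range ∩ closure (closure D.carrier \ S)).Nonempty} :=
          measure_union_le _ _
      _ = P O := by rw [hnull, add_zero]
  -- sequential characterisation of the limit along the countably generated filter `𝓝[>] 0`
  refine tendsto_of_seq_tendsto fun s hs => ?_
  have hweak : ∀ f : CurveClass ℂ →ᵇ ℝ, Tendsto
      (fun n => ∫ γ, f γ.curve ∂law D.carrier (s n) (a (s n)) (b (s n))) atTop (𝓝 (∫ x, f x ∂P)) :=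
    fun f => (hlim f).comp hs
  obtain ⟨hclosed, hopen⟩ := stub_portmanteau D.carrier a b s P hP hweak
  -- notation: the pushed-forward laws along the sequence
  set μ : ℕ → Measure (CurveClass ℂ) := fun n =>
    (law D.carrier (s n) (a (s n)) (b (s n))).map (fun γ => γ.curve) with hμ
  have h_up : limsup (fun n => μ n A) atTop ≤ P A := hclosed A hAclosed
  have h_lowO : P O ≤ liminf (fun n => μ n O) atTop := hopen O hOopen
  -- on lattice curves (which live in `cl D` once the endpoints are distinct) `O ⊆ A`
  have hOA : ∀ᶠ n in atTop, μ n O ≤ μ n A := by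
    filter_upwards [eventually_ne_of_hyps hab hs] with n hne
    simp only [hμ]
    rw [Measure.map_apply (DomainSAW.measurable_of_top _) hOopen.measurableSet,
      Measure.map_apply (DomainSAW.measurable_of_top _) hAclosed.measurableSet]
    refine measure_mono fun γ hγ => ?_
    simp only [mem_preimage] at hγ ⊢
    intro x hx
    by_contra hxS
    have hxD : x ∈ closure D.carrier := range_curve_subset_closure hne γ hx
    exact hγ hx (subset_closure ⟨hxD, hxS⟩)
  have h_low : P A ≤ liminf (fun n => μ n A) atTop :=
    hPAO.trans (h_lowO.trans (liminf_le_liminf hOA))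
  exact tendsto_of_le_liminf_of_limsup_le h_low h_up

/-- **`(∃ P, chordal ∧ (lim) ∧ null touching) → AvoidanceCocycleLimit`.**  If the critical `δℤ²` SAW laws
have a full scaling limit `P` (the crux `LimitExists` with its witness) and, for every Dobrushin `D` and
every hull subdomain `D' ⊆ D` with the same marked points agreeing with `D` near them, `P D` gives no
mass to the chords staying in `cl D'` that touch `cl (cl D ∖ cl D')`, then the hull-avoidance
probabilities converge along the full filter (to `P D (range ⊆ cl D')`): the registered stub (C) =
item stmt-CriticalPhenomena-1369 adds to the crux exactly this regularity of the limit.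
[cite: BillingsleyCPM1999, Thm. 2.1] -/
theorem avoidanceCocycleLimit_of_limit_nullTouching : (∃ P : Literature.Probability.RandomPlanarGeometry.ChordalFamily, P.IsChordal ∧ (∀ (D : Literature.Probability.RandomPlanarGeometry.DobrushinDomain) (a b : ℝ → Literature.Probability.LatticeModels.Site 2), Literature.Probability.RandomPlanarGeometry.SAW.IsEndpointApprox D a b → Literature.Probability.RandomPlanarGeometry.TendstoLaw (fun δ (γ : Literature.Probability.RandomPlanarGeometry.SAW.DomainSAW D.carrier δ (a δ) (b δ)) => γ.curve) (fun δ => Literature.Probability.RandomPlanarGeometry.SAW.law D.carrier δ (a δ) (b δ)) id (P D)) ∧ (∀ (D D' : Literature.Probability.RandomPlanarGeometry.DobrushinDomain), D'.carrier ⊆ D.carrier → D'.pt 0 = D.pt 0 → D'.pt 1 = D.pt 1 → (∃ ε : ℝ, 0 < ε ∧ D'.carrier ∩ Metric.ball (D.pt 0) ε = D.carrier ∩ Metric.ball (D.pt 0) ε ∧ D'.carrier ∩ Metric.ball (D.pt 1) ε = D.carrier ∩ Metric.ball (D.pt 1) ε) → P D {γ | γ.range ⊆ closure D'.carrier ∧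 (γ.range ∩ closure (closure D.carrier \ closure D'.carrier)).Nonempty} = 0)) → Summit.CriticalPhenomena.SAWScalingLimit.Theses.SAWRestrictionRigidity.AvoidanceCocycleLimit := by
  rintro ⟨P, hPch, hlim, hnull⟩ D D' a b hab hsub h0 h1 hε
  haveI : IsProbabilityMeasure (P D) := (hPch D).1
  refine ⟨P D (CurveClass.rangeSubset (closure D'.carrier)), ?_⟩
  refine tendsto_measure_rangeSubset_of_nullTouching hab (P := P D) (fun f => ?_) isClosed_closure
    (hnull D D' hsub h0 h1 hε)
  simpa only [id_eq] using hlim D a b hab f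

end Summit.CriticalPhenomena.SAWScalingLimit.Theorems.SAWRestrictionRigidityLimitExists

end
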